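import Literature.AlgebraicGeometry.Motives.MixedHodgeStructureLoewyLength
import Literature.AlgebraicGeometry.Motives.MixedHodgeStructureSemisimpleSplitting
import HarnessLib

/-!
# Subadditivity of the Loewy length: `ℓ(H) ≤ ℓ(H/S) + ℓ(S)`

For an object of finite length of an abelian category — here a mixed Hodge structure on a finite-dimensional
`ℚ`-space (Cattani–El Zein–Griffiths–Lê, *Hodge Theory*, Thm. 3.2.18; semisimple objects p. 270) — the Loewy length
(`MixedHodgeStructureLoewyLength`) is subadditive in short exact sequences `0 → S → H → H/S → 0`: the radical series
satisfies `rad^{a+b} H = rad^b(rad^a H)` (`radicalSeries_add`), `rad^{ℓ(H/S)} H ⊆ S` (functoriality along `H ↠ H/S`),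
and `rad^{ℓ(S)}` of a sub-MHS of `S` vanishes (functoriality along `⊆ S`). For Carlson's extensions
`0 → B → E → A → 0` this reads **`ℓ(E) ≤ ℓ(A) + ℓ(B)`**. Namespace `MixedHodgeStructure`; everything proved, no named
facts.

## References

* [CattaniElZeinGriffithsLe2014] E. Cattani et al. (eds.), Hodge Theory (2014), Thm. 3.2.18, Lemma 3.2.20, p. 270.
* [Carlson1980] J. Carlson, Extensions of mixed Hodge structures (Angers 1979), §2(b).
-/

noncomputable section

namespace Literature.AlgebraicGeometry.Motives

namespace MixedHodgeStructure

universe u v w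

variable {V : Type u} [AddCommGroup V] [Module ℚ V] [FiniteDimensional ℚ V]
variable {H : MixedHodgeStructure V}

open Module

/-! ### §1 `rad^{a+b} H = rad^b (rad^a H)` -/

namespace SubMixedHodgeStructure

/-- The isomorphism `R' ⥲ R.ofSub R'` (a sub-MHS of the sub-MHS `R`, seen inside `H`), compatible with the inclusions.
[cite: CattaniElZeinGriffithsLe2014, Lemma 3.2.20] -/
def ofSubHom (R : SubMixedHodgeStructure H) (R' : SubMixedHodgeStructure R.toMixedHodgeStructure) :
    Hom R'.toMixedHodgeStructure (R.ofSub R').toMixedHodgeStructure :=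
  (R.ofSub R').codRestrict (R.subtype.comp R'.subtype) fun x => ⟨(x : R.toSubmodule), x.2, rfl⟩

omit [FiniteDimensional ℚ V] in
/-- Underlying vectors: `ofSubHom x = x`. [cite: CattaniElZeinGriffithsLe2014, Lemma 3.2.20] -/
@[simp]
theorem coe_ofSubHom_apply (R : SubMixedHodgeStructure H) (R' : SubMixedHodgeStructure R.toMixedHodgeStructure)
    (x : R'.toSubmodule) : (((R.ofSubHom R').toLinearMap x : (R.ofSub R').toSubmodule) : V) = ((x : R.toSubmodule) : V) :=
  rfl

omit [FiniteDimensional ℚ V] in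
/-- `ofSubHom` is bijective. [cite: CattaniElZeinGriffithsLe2014, Lemma 3.2.20] -/
theorem ofSubHom_bijective (R : SubMixedHodgeStructure H) (R' : SubMixedHodgeStructure R.toMixedHodgeStructure) :
    Function.Bijective (R.ofSubHom R').toLinearMap := by
  constructor
  · intro x y hxy
    have h := congrArg (fun z : ↥(R.ofSub R').toSubmodule => (z : V)) hxy
    simp only [coe_ofSubHom_apply] at h
    exact Subtype.ext (Subtype.ext h)
  · rintro ⟨v, hv⟩
    obtain ⟨y, hy, rfl⟩ := Submodule.mem_map.1 hv
    exact ⟨⟨y, hy⟩, rfl⟩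

omit [FiniteDimensional ℚ V] in
/-- `(R.ofSub R' ↪ H) ∘ ofSubHom = (R ↪ H) ∘ (R' ↪ R)`. [cite: CattaniElZeinGriffithsLe2014, Lemma 3.2.20] -/
theorem subtype_comp_ofSubHom (R : SubMixedHodgeStructure H) (R' : SubMixedHodgeStructure R.toMixedHodgeStructure) :
    (R.ofSub R').toSubmodule.subtype ∘ₗ (R.ofSubHom R').toLinearMap = R.toSubmodule.subtype ∘ₗ R'.toSubmodule.subtype :=
  LinearMap.ext fun _ => rfl

/-- **The radical of `R' ⊆ R ⊆ H` computed inside `R` or inside `H` is the same subspace of `V`.**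
[cite: CattaniElZeinGriffithsLe2014, Thm. 3.2.18 and p. 270] -/
theorem map_subtype_radical_ofSub (R : SubMixedHodgeStructure H) (R' : SubMixedHodgeStructure R.toMixedHodgeStructure) :
    (radical (R.ofSub R').toMixedHodgeStructure).toSubmodule.map (R.ofSub R').toSubmodule.subtype =
      ((radical R'.toMixedHodgeStructure).toSubmodule.map R'.toSubmodule.subtype).map R.toSubmodule.subtype := by
  rw [← map_radical_eq_of_bijective (R.ofSubHom R') (R.ofSubHom_bijective R'), ← Submodule.map_comp,
    subtype_comp_ofSubHom, Submodule.map_comp]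

end SubMixedHodgeStructure

open SubMixedHodgeStructure

/-- **`rad^{a+b} H = rad^b (rad^a H)`** (as subspaces of `V`). [cite: CattaniElZeinGriffithsLe2014, Thm. 3.2.18 and p. 270] -/
theorem radicalSeries_add (H : MixedHodgeStructure V) (a b : ℕ) :
    (radicalSeries H (a + b)).toSubmodule =
      (radicalSeries (radicalSeries H a).toMixedHodgeStructure b).toSubmodule.map (radicalSeries H a).toSubmodule.subtype := by
  induction b with
  | zero =>
    rw [Nat.add_zero, radicalSeries_zero, SubMixedHodgeStructure.top_toSubmodule, Submodule.map_top, Submodule.range_subtype]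
  | succ b ih =>
    -- `rad^{a+b} H = (rad^a H).ofSub (rad^b (rad^a H))` as sub-MHS of `H`
    have e : radicalSeries H (a + b) =
        (radicalSeries H a).ofSub (radicalSeries (radicalSeries H a).toMixedHodgeStructure b) :=
      SubMixedHodgeStructure.ext (by rw [ih]; rfl)
    have e' := congrArg (fun Z : SubMixedHodgeStructure H =>
      (radical Z.toMixedHodgeStructure).toSubmodule.map Z.toSubmodule.subtype) e
    rw [show a + (b + 1) = (a + b) + 1 from rfl, radicalSeries_succ_toSubmodule, radicalSeries_succ_toSubmodule]
    exact e'.trans (map_subtype_radical_ofSub _ _)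

/-! ### §2 `ℓ(H) ≤ ℓ(H/S) + ℓ(S)` -/

/-- `rad^{ℓ(H/S)} H ⊆ S`. [cite: CattaniElZeinGriffithsLe2014, Thm. 3.2.18 and p. 270] -/
theorem radicalSeries_loewyLength_quotient_le (S : SubMixedHodgeStructure H) :
    (radicalSeries H (loewyLength S.quotient)).toSubmodule ≤ S.toSubmodule := fun x hx => by
  have h := S.mkQ.apply_mem_radicalSeries (k := loewyLength S.quotient) hx
  rw [radicalSeries_loewyLength_eq_bot, Submodule.mem_bot] at h
  exact (Submodule.Quotient.mk_eq_zero _).1 h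

/-- `rad^{ℓ(S)}` of a sub-MHS `R ⊆ S` vanishes. [cite: CattaniElZeinGriffithsLe2014, Thm. 3.2.18 and p. 270] -/
theorem radicalSeries_loewyLength_eq_bot_of_le (R S : SubMixedHodgeStructure H) (h : R.toSubmodule ≤ S.toSubmodule) :
    (radicalSeries R.toMixedHodgeStructure (loewyLength S.toMixedHodgeStructure)).toSubmodule = ⊥ := by
  let ι : Hom R.toMixedHodgeStructure S.toMixedHodgeStructure := S.codRestrict R.subtype fun z => h z.2
  rw [eq_bot_iff]
  intro y hy
  have h' := ι.apply_mem_radicalSeries (k := loewyLength S.toMixedHodgeStructure) hy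
  rw [radicalSeries_loewyLength_eq_bot, Submodule.mem_bot] at h'
  have h'' := congrArg (fun z : ↥S.toSubmodule => (z : V)) h'
  simp only [Submodule.coe_zero] at h''
  rw [Submodule.mem_bot]
  exact Subtype.ext h''

/-- **Subadditivity: `ℓ(H) ≤ ℓ(H/S) + ℓ(S)`** for every sub-MHS `S`. [cite: CattaniElZeinGriffithsLe2014, Thm. 3.2.18 and p. 270] -/
theorem SubMixedHodgeStructure.loewyLength_le_add (S : SubMixedHodgeStructure H) :
    loewyLength H ≤ loewyLength S.quotient + loewyLength S.toMixedHodgeStructure := by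
  rw [loewyLength_le_iff_radicalSeries_eq_bot, radicalSeries_add, eq_bot_iff]
  intro x hx
  obtain ⟨y, hy, rfl⟩ := Submodule.mem_map.1 hx
  have h0 := radicalSeries_loewyLength_eq_bot_of_le (radicalSeries H (loewyLength S.quotient)) S
    (radicalSeries_loewyLength_quotient_le S)
  rw [h0, Submodule.mem_bot] at hy
  rw [hy, map_zero]
  exact Submodule.zero_mem _

/-- With the opposite bounds `ℓ(S), ℓ(H/S) ≤ ℓ(H)`: `max (ℓ S) (ℓ (H/S)) ≤ ℓ H ≤ ℓ S + ℓ (H/S)`.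
[cite: CattaniElZeinGriffithsLe2014, Thm. 3.2.18 and p. 270] -/
theorem SubMixedHodgeStructure.max_loewyLength_le (S : SubMixedHodgeStructure H) :
    max (loewyLength S.toMixedHodgeStructure) (loewyLength S.quotient) ≤ loewyLength H :=
  max_le S.loewyLength_le S.loewyLength_quotient_le

/-! ### §3 Extensions -/

namespace Extension

variable {VA : Type v} [AddCommGroup VA] [Module ℚ VA] [FiniteDimensional ℚ VA]
variable {VB : Type w} [AddCommGroup VB] [Module ℚ VB] [FiniteDimensional ℚ VB]
variable {A : MixedHodgeStructure VA} {B : MixedHodgeStructure VB} (E : Extension A B V)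

omit [FiniteDimensional ℚ V] [FiniteDimensional ℚ VA] [FiniteDimensional ℚ VB] in
/-- The induced morphism `E / i(B) → A` is injective. [cite: Carlson1980, §2(b)] -/
theorem quotientLift_range_inc_injective :
    Function.Injective (E.inc.range.quotientLift E.proj
      (by rw [Hom.range_toSubmodule, E.range_inc])).toLinearMap := by
  rw [← LinearMap.ker_eq_bot]
  exact Submodule.ker_liftQ_eq_bot _ _ _ (by rw [Hom.range_toSubmodule, E.range_inc])

omit [FiniteDimensional ℚ VB] in
/-- `ℓ(E / i(B)) ≤ ℓ(A)` (indeed equal). [cite: Carlson1980, §2(b)] -/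
theorem loewyLength_quotient_range_inc_le : loewyLength E.inc.range.quotient ≤ loewyLength A :=
  Hom.loewyLength_le_of_injective _ E.quotientLift_range_inc_injective

omit [FiniteDimensional ℚ VA] in
/-- `ℓ(i(B)) ≤ ℓ(B)` (indeed equal). [cite: Carlson1980, §2(b)] -/
theorem loewyLength_range_inc_le : loewyLength E.inc.range.toMixedHodgeStructure ≤ loewyLength B :=
  E.inc.rangeRestrict.loewyLength_le_of_surjective E.inc.rangeRestrict_surjective

/-- **`ℓ(E) ≤ ℓ(A) + ℓ(B)` for an extension `0 → B → E → A → 0`.** [cite: CattaniElZeinGriffithsLe2014, Thm. 3.2.18 and p. 270]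
[cite: Carlson1980, §2(b)] -/
theorem loewyLength_le_add : loewyLength E.mhs ≤ loewyLength A + loewyLength B :=
  E.inc.range.loewyLength_le_add.trans (Nat.add_le_add E.loewyLength_quotient_range_inc_le E.loewyLength_range_inc_le)

omit [FiniteDimensional ℚ VA] in
/-- **A non-split extension with semisimple non-zero ends has `ℓ(E) = 2`.** [cite: Carlson1980, §2(b)]
[cite: CattaniElZeinGriffithsLe2014, p. 270] -/
theorem loewyLength_eq_two_of_not_isSplit (hA : A.IsSemisimple) (hB : B.IsSemisimple) (h : ¬E.IsSplit) :
    loewyLength E.mhs = 2 := by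
  refine le_antisymm (E.loewyLength_le_two hA hB) ?_
  by_contra hlt
  rw [not_le] at hlt
  have h1 : loewyLength E.mhs ≤ 1 := by omega
  exact h (E.isSplit_of_isSemisimple_mhs (loewyLength_le_one_iff.1 h1))

end Extension

end MixedHodgeStructure

end Literature.AlgebraicGeometry.Motives
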